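import Mathlib.Analysis.Fourier.PoissonSummation
import Literature.Analysis.Fourier.L2FourierDilation
import Literature.NumberTheory.LFunctions.AlternativeHypothesisFormFactor
import HarnessLib

/-!
# BGSTB 2025, Theorem 4 (an application of AH-Density) — proved for continuous test functions;
# the literal typing `bgstb2025_theorem4` is inconsistent with AH-Density

Topic `Literature/NumberTheory/LFunctions` (namespace `Literature.NumberTheory.LFunctions`; helpers in
the sub-namespace `AH`). PROOF LAYER for the claim `bgstb2025_theorem4` of
`AlternativeHypothesisFormFactor.lean` (cell `rh-crit/ah`, C5, seat t5); theorems only, no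
definitions, no named facts. LABEL: **NOT RH-BEARING** — a Poisson-summation identity for test
functions, conditional on the AH-Density PREDICATE (consumed as a hypothesis, never asserted);
nothing here bears on the truth of RH or of AH.

## What the source prints (held TeX text `paper:arxiv-2508.10857`, chunks p0008, p0018)

S. A. C. Baluyot, D. A. Goldston, A. I. Suriajaya, C. L. Turnage-Butterbaugh, *The Alternative
Hypothesis for zeros of the Riemann zeta-function*, arXiv:2508.10857 (2025; UNREFEREED, D-0012):

* **Theorem 4** (p0008:L69–L71): "Suppose both `r(t)` and `r̂(α)` are even `L¹(ℝ)` functions with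
  bounded variation, and suppose further that `r(α)` has support in `|α| ≤ 1`. Then assuming
  AH-Density, we have `∑_{k∈ℤ} r̂(k/2) p_{k/2} = r(0) + 2∫_0^1 α r(α) dα`."
* **§8, proof** (p0018): with `p̃_0 = p_0 − 1`, split `𝒮(r) := ∑_k r̂(k/2) p_{k/2}` along the
  AH-Density table; "(PSF) `∑_k λ f(λk) = ∑_k f̂(k/λ)` … holds as stated above if `f ∈ L¹(ℝ)` is
  even and of bounded variation, and `f̂ ∈ L¹(ℝ)` [Montgomery–Vaughan 2007]"; "taking `λ = 1` …
  `∑_k r̂(k) = ∑_k r(k)`. **Since `r(α)` is continuous** and supported in `|α| ≤ 1`, we have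
  `r(k) = 0` for `k ≠ 0`, and therefore `∑_{k even} r̂(k/2) = ∑_k r̂(k) = r(0)`"; "taking `λ = 2` …
  `∑_k r̂(k/2) = 2∑_k r(2k) = 2r(0)`" whence (even = odd) `∑_{k even} r̂(k/2) = ∑_{k odd} r̂(k/2)`;
  "`r(α) = ½∑_k r̂(k/2) e(kα/2)` for `|α| ≤ 1`, where the series converges to `r(α)` by bounded
  variation. Thus `r(0) + 2∫_0^1 α r(α) dα = ½∑_k r̂(k/2) + ∑_k r̂(k/2) Re∫_0^1 α e(kα/2) dα
  = ½∑_k r̂(k/2) − (2/π²)∑_{k odd} r̂(k/2)/k²`, which by (S(r)1) completes the proof."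

## What is proved here, and the typing erratum (cell `rh-crit/ah`, E-ah-4)

* `bgstb2025_theorem4_of_continuous` — Theorem 4 exactly as typed in `bgstb2025_theorem4`, with
  ONE hypothesis added: `Continuous r`. The printed proof uses the continuity of `r` (quote above);
  for the authors an `L¹` function whose transform is `L¹` "is" continuous (functions are taken
  up to a.e. equality), but the typed conclusion mentions the pointwise values `r(0)` and `r(α)`,
  so for an arbitrary `r : ℝ → ℝ` the hypothesis has to be explicit.
* `not_ahDensity_of_bgstb2025_theorem4` — WITHOUT that hypothesis the typed claim is not a
  harmless weakening: the indicator of `{0}` satisfies every typed hypothesis (it is a.e. zero, so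
  its transform is `0 ∈ L¹ ∩ BV`) and turns the conclusion into `0 = 1`; hence, as typed,
  `bgstb2025_theorem4 → ¬ AHDensity δ` for every admissible `δ`. The literal def is left untouched
  (its docstring already marks it a CLAIM, not proved); this file supplies the corrected statement
  with a proof and records the defect.
* `AH.tsum_fourier_half_mul_densityTable` — the AH-free Fourier-analytic core: for a continuous even
  `r` supported in `[-1, 1]` with `∑_k |r̂(k/2)| < ∞` and ANY real `p₀`,
  `∑_k r̂(k/2) · densityTable p₀ k = r(0) + 2∫_0^1 α r(α) dα` (the `p₀`-terms cancel).

## Proof route (follows §8; the two deviations are marked)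

1. (deviation) Instead of the bounded-variation Poisson summation formula of Montgomery–Vaughan,
   we note that `r̂ ∈ L¹ ∩ BV(ℝ)` gives `∑_k |r̂(k/2)| < ∞` (`AH.summable_norm_sample`:
   `h|g(kh)| ≤ ∫_{kh}^{(k+1)h} |g| + h·V(g; [kh,(k+1)h])`), after which Mathlib's Poisson summation
   for continuous, compactly supported `f` with `∑_n |f̂(n)| < ∞`
   (`Real.tsum_eq_tsum_fourier_of_rpow_decay_of_summable`) applies to `r` and to `x ↦ r(2x)`
   (transform `ξ ↦ ½ r̂(ξ/2)`, the tree's `Literature.Analysis.Fourier.fourierIntegral_comp_mul_left`):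
   `∑_k r̂(k) = r(0)` (`AH.tsum_fourier_int_eq`), `∑_k r̂(k/2) = 2r(0)` (`AH.tsum_fourier_half_eq`),
   even/odd halves both `= r(0)` (`AH.tsum_fourier_half_even_eq`, `AH.tsum_fourier_half_odd_eq`), and
   the expansion `r(α) = ½∑_k r̂(k/2) e^{iπkα}` on `[-1, 1]` (`AH.eq_tsum_fourier_half_mul_exp`).
2. (deviation) The termwise integration against `|α|` is justified by absolute convergence, not by
   bounded variation (`AH.integral_abs_mul_eq_tsum`); the moments `∫_{-1}^1 |α| e^{iπkα} dα`
   (`= 1` for `k = 0`, `= 2((−1)^k − 1)/(π²k²)` otherwise) are `AH.integral_abs_mul_exp_zero`,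
   `AH.integral_abs_mul_exp` (FTC with the antiderivative `(1/c² − ix/c)e^{icx}` of `x e^{icx}`).
3. Assembly as printed. (Remark for the referee: the first display of §8 writes the `k = 0`
   coefficient as `p_0 − ½` instead of `p_0`, i.e. drops `½ r̂(0)`; its last display drops the same
   `½ r̂(0)` (the `k = 0` term of `∑_k r̂(k/2) Re∫_0^1 α e(kα/2) dα`), so Theorem 4 as printed is
   correct. Here both sides are computed in full.)

## References

* [BaluyotGoldstonSuriajayaTurnageButterbaugh2025] arXiv:2508.10857, Theorem 4 (p. 8) and §8 (p. 18).
* [MontgomeryVaughan2007] H. L. Montgomery, R. C. Vaughan, *Multiplicative Number Theory I*,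
  Appendix D (Poisson summation) — cited by the source; not used here.
-/

noncomputable section

open Filter Set MeasureTheory Asymptotics
open scoped Real Topology FourierTransform

namespace Literature.NumberTheory.LFunctions

namespace AH

/-! ## §1. Samples of an integrable function of bounded variation are summable -/

/-- For `g ∈ L¹(ℝ)` of bounded variation and a step `h > 0`: on each period,
`h ‖g(kh)‖ ≤ ∫_{(kh, (k+1)h]} ‖g‖ + h · V(g; [kh, (k+1)h])`. [folklore] -/
private theorem mul_norm_sample_le {E : Type*} [NormedAddCommGroup E] {g : ℝ → E}
    (hg : Integrable g) (hbv : BoundedVariationOn g univ) {h : ℝ} (hh : 0 < h) (k : ℤ) :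
    h * ‖g (k * h)‖ ≤
      (∫ t in Ioc ((k : ℝ) * h) ((k + 1) * h), ‖g t‖) +
        h * (eVariationOn g (Icc ((k : ℝ) * h) ((k + 1) * h))).toReal := by
  set a : ℝ := k * h with ha
  set b : ℝ := (k + 1) * h with hb
  have hba : b - a = h := by rw [ha, hb]; ring
  have hab : a ≤ b := by linarith
  have hbvk : BoundedVariationOn g (Icc a b) := hbv.mono (subset_univ _)
  have hpt : ∀ t ∈ Ioc a b, ‖g a‖ ≤ ‖g t‖ + (eVariationOn g (Icc a b)).toReal := by
    intro t ht
    have hd := hbvk.dist_le (left_mem_Icc.mpr hab) (Ioc_subset_Icc_self ht)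
    calc ‖g a‖ = ‖g t + (g a - g t)‖ := by rw [add_sub_cancel]
      _ ≤ ‖g t‖ + ‖g a - g t‖ := norm_add_le _ _
      _ = ‖g t‖ + dist (g a) (g t) := by rw [dist_eq_norm]
      _ ≤ ‖g t‖ + (eVariationOn g (Icc a b)).toReal := by gcongr
  have hvol : volume.real (Ioc a b) = h := by rw [Real.volume_real_Ioc_of_le hab, hba]
  have hconst : ∀ c : ℝ, IntegrableOn (fun _ : ℝ ↦ c) (Ioc a b) := fun c ↦
    integrableOn_const measure_Ioc_lt_top.ne
  have hgn : IntegrableOn (fun t ↦ ‖g t‖) (Ioc a b) := hg.norm.integrableOn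
  calc h * ‖g a‖ = ∫ _ in Ioc a b, ‖g a‖ := by rw [setIntegral_const, hvol, smul_eq_mul]
    _ ≤ ∫ t in Ioc a b, (‖g t‖ + (eVariationOn g (Icc a b)).toReal) :=
        setIntegral_mono_on (hconst _) (hgn.add (hconst _)) measurableSet_Ioc hpt
    _ = (∫ t in Ioc a b, ‖g t‖) + h * (eVariationOn g (Icc a b)).toReal := by
        rw [integral_add hgn (hconst _), setIntegral_const, hvol, smul_eq_mul]

/-- The variations over the periods `[kh, (k+1)h]`, `k` in a finite set of integers, add up to at
most the total variation. [folklore] -/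
private theorem sum_eVariationOn_Icc_le {E : Type*} [PseudoEMetricSpace E] (g : ℝ → E) {h : ℝ}
    (hh : 0 < h) (F : Finset ℤ) :
    ∑ k ∈ F, eVariationOn g (Icc ((k : ℝ) * h) ((k + 1) * h)) ≤ eVariationOn g univ := by
  classical
  obtain ⟨m, hm⟩ := F.bddBelow
  obtain ⟨M, hM⟩ := F.bddAbove
  set N : ℕ := (M - m + 1).toNat with hN
  set I : ℕ → ℝ := fun i ↦ ((m : ℝ) + i) * h with hI
  have hImono : Monotone I := fun i j hij ↦ by
    simp only [hI]
    gcongr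
  have hsub : F ⊆ (Finset.range N).image (fun i : ℕ ↦ m + i) := by
    intro k hk
    have h1 : m ≤ k := hm hk
    have h2 : k ≤ M := hM hk
    refine Finset.mem_image.mpr ⟨(k - m).toNat, ?_, ?_⟩
    · rw [Finset.mem_range]; omega
    · omega
  calc ∑ k ∈ F, eVariationOn g (Icc ((k : ℝ) * h) ((k + 1) * h))
      ≤ ∑ k ∈ (Finset.range N).image (fun i : ℕ ↦ m + i),
          eVariationOn g (Icc ((k : ℝ) * h) ((k + 1) * h)) :=
        Finset.sum_le_sum_of_subset hsub
    _ = ∑ i ∈ Finset.range N, eVariationOn g (Icc (I i) (I (i + 1))) := by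
        rw [Finset.sum_image (fun i _ j _ hij ↦ by simpa using hij)]
        refine Finset.sum_congr rfl fun i _ ↦ ?_
        have e1 : ((m + (i : ℤ) : ℤ) : ℝ) * h = I i := by
          simp only [hI]; push_cast; ring
        have e2 : (((m + (i : ℤ) : ℤ) : ℝ) + 1) * h = I (i + 1) := by
          simp only [hI]; push_cast; ring
        rw [e1, e2]
    _ = eVariationOn g (Icc (I 0) (I N)) := eVariationOn.sum' g hImono
    _ ≤ eVariationOn g univ := eVariationOn.mono g (subset_univ _)

/-- **Samples of an integrable function of bounded variation are summable**: if `g ∈ L¹(ℝ)` has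
bounded variation on `ℝ` and `h > 0`, then `∑_{k ∈ ℤ} ‖g(kh)‖ < ∞` (indeed
`h ∑_k ‖g(kh)‖ ≤ ‖g‖₁ + h V(g)`). This replaces, for the purpose of Poisson summation at the points
`k/2`, the bounded-variation form of the Poisson summation formula quoted by BGSTB 2025 (§8) from
Montgomery–Vaughan 2007. [folklore] -/
private theorem summable_norm_sample {E : Type*} [NormedAddCommGroup E] {g : ℝ → E}
    (hg : Integrable g) (hbv : BoundedVariationOn g univ) {h : ℝ} (hh : 0 < h) :
    Summable fun k : ℤ ↦ ‖g (k * h)‖ := by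
  classical
  have hh0 : 0 ≤ h := hh.le
  set V : ℝ := (eVariationOn g univ).toReal with hV
  refine summable_of_sum_le (c := ((∫ t, ‖g t‖) + h * V) / h) (fun k ↦ norm_nonneg _)
    fun F ↦ ?_
  rw [le_div_iff₀ hh, Finset.sum_mul]
  have h1 : ∀ k ∈ F, ‖g (k * h)‖ * h ≤ (∫ t in Ioc ((k : ℝ) * h) ((k + 1) * h), ‖g t‖) +
      h * (eVariationOn g (Icc ((k : ℝ) * h) ((k + 1) * h))).toReal := fun k _ ↦ by
    rw [mul_comm]
    exact mul_norm_sample_le hg hbv hh k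
  refine (Finset.sum_le_sum h1).trans ?_
  rw [Finset.sum_add_distrib, ← Finset.mul_sum]
  have hdisj : Set.Pairwise (↑F : Set ℤ)
      (Function.onFun Disjoint fun k : ℤ ↦ Ioc ((k : ℝ) * h) ((k + 1) * h)) := by
    intro k _ k' _ hkk'
    change Disjoint (Ioc _ _) (Ioc _ _)
    rcases lt_or_gt_of_ne hkk' with hlt | hlt
    · refine Set.disjoint_left.mpr fun t ht ht' ↦ ?_
      have hle : ((k : ℝ) + 1) * h ≤ (k' : ℝ) * h := by
        have : k + 1 ≤ k' := hlt
        have : (k : ℝ) + 1 ≤ k' := by exact_mod_cast this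
        exact mul_le_mul_of_nonneg_right this hh0
      linarith [ht.2, ht'.1]
    · refine Set.disjoint_left.mpr fun t ht ht' ↦ ?_
      have hle : ((k' : ℝ) + 1) * h ≤ (k : ℝ) * h := by
        have : k' + 1 ≤ k := hlt
        have : (k' : ℝ) + 1 ≤ k := by exact_mod_cast this
        exact mul_le_mul_of_nonneg_right this hh0
      linarith [ht'.2, ht.1]
  have hint : ∑ k ∈ F, ∫ t in Ioc ((k : ℝ) * h) ((k + 1) * h), ‖g t‖ ≤ ∫ t, ‖g t‖ := by
    rw [← integral_biUnion_finset F (fun k _ ↦ measurableSet_Ioc) hdisj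
      (fun k _ ↦ hg.norm.integrableOn)]
    exact setIntegral_le_integral hg.norm (Eventually.of_forall fun t ↦ norm_nonneg _)
  have hvar : ∑ k ∈ F, (eVariationOn g (Icc ((k : ℝ) * h) ((k + 1) * h))).toReal ≤ V := by
    rw [hV, ← ENNReal.toReal_sum (fun k _ ↦ ?_)]
    · exact ENNReal.toReal_mono hbv (sum_eVariationOn_Icc_le g hh F)
    · exact ne_top_of_le_ne_top hbv (eVariationOn.mono g (subset_univ _))
  gcongr

/-! ## §2. Poisson summation for a continuous test function supported in `[-1, 1]` -/

/-- A continuous function vanishing for `|t| > 1` vanishes for `|t| ≥ 1`. [folklore] -/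
private theorem eq_zero_of_one_le_abs {r : ℝ → ℝ} (hc : Continuous r)
    (hsupp : ∀ t, 1 < |t| → r t = 0) (t : ℝ) (ht : 1 ≤ |t|) : r t = 0 := by
  rcases ht.lt_or_eq with hlt | heq
  · exact hsupp t hlt
  · have hmem : t ∈ closure {s : ℝ | 1 < |s|} := by
      rw [Metric.mem_closure_iff]
      intro ε hε
      refine ⟨(1 + ε / 2) * t, ?_, ?_⟩
      · show 1 < |(1 + ε / 2) * t|
        rw [abs_mul, ← heq, mul_one, abs_of_pos (by linarith)]
        linarith
      · rw [dist_eq_norm, Real.norm_eq_abs, show t - (1 + ε / 2) * t = -(ε / 2 * t) by ring,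
          abs_neg, abs_mul, ← heq, mul_one, abs_of_pos (by linarith)]
        linarith
    have hclosed : IsClosed {s : ℝ | r s = 0} := isClosed_eq hc continuous_const
    exact (hclosed.closure_subset_iff.mpr fun s hs ↦ hsupp s hs) hmem

/-- A function vanishing for `|t| ≥ 1` is `O(|x|^{-b})` along the cocompact filter (trivially).
[folklore] -/
private theorem isBigO_cocompact_rpow_of_eq_zero {F : ℝ → ℂ} (hF : ∀ t, 1 ≤ |t| → F t = 0) (b : ℝ) :
    F =O[cocompact ℝ] fun x : ℝ ↦ |x| ^ (-b) := by
  refine Asymptotics.IsBigO.of_bound 1 ?_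
  filter_upwards [tendsto_norm_cocompact_atTop.eventually (eventually_ge_atTop (1 : ℝ))]
    with x hx
  rw [Real.norm_eq_abs] at hx
  rw [hF x hx, norm_zero]
  positivity

/-- **Poisson summation at the integers** for a continuous `r` supported in `[-1, 1]` whose
Fourier transform is summable over `ℤ`: `∑_{k ∈ ℤ} r̂(k) = r(0)` (BGSTB 2025, §8, "taking `λ = 1`
in (PSF)": the left side `∑_k r(k)` reduces to `r(0)` since `r(k) = 0` for `k ≠ 0`). Mathlib's
`Real.tsum_eq_tsum_fourier_of_rpow_decay_of_summable`.
[cite: BaluyotGoldstonSuriajayaTurnageButterbaugh2025, §8 (proof of Theorem 4)] -/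
theorem tsum_fourier_int_eq {r : ℝ → ℝ} (hc : Continuous r) (hsupp : ∀ t, 1 < |t| → r t = 0)
    (hsum : Summable fun n : ℤ ↦ 𝓕 (fun t : ℝ ↦ (r t : ℂ)) n) :
    ∑' n : ℤ, 𝓕 (fun t : ℝ ↦ (r t : ℂ)) n = r 0 := by
  have h0 := eq_zero_of_one_le_abs hc hsupp
  have hcc : Continuous fun t : ℝ ↦ (r t : ℂ) := Complex.continuous_ofReal.comp hc
  have hO : (fun t : ℝ ↦ (r t : ℂ)) =O[cocompact ℝ] fun x : ℝ ↦ |x| ^ (-(2 : ℝ)) :=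
    isBigO_cocompact_rpow_of_eq_zero (fun t ht ↦ by simp [h0 t ht]) 2
  have hpsf := Real.tsum_eq_tsum_fourier_of_rpow_decay_of_summable hcc one_lt_two hO hsum 0
  have hlhs : ∑' n : ℤ, ((r (0 + n) : ℝ) : ℂ) = r 0 := by
    rw [tsum_eq_single 0]
    · simp
    · intro n hn
      have h1 : (1 : ℝ) ≤ |(n : ℝ)| := by exact_mod_cast Int.one_le_abs hn
      simp [h0 _ h1]
  rw [hlhs] at hpsf
  rw [hpsf]
  refine tsum_congr fun n ↦ ?_
  rw [QuotientAddGroup.mk_zero, fourier_eval_zero, mul_one]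

/-- **The Fourier expansion on `[-1, 1]`** of a continuous `r` supported there, with absolutely
summable coefficients: for `|α| ≤ 1`, `r(α) = ½ ∑_{k ∈ ℤ} r̂(k/2) e(kα/2)` (BGSTB 2025, §8:
"`r(α) = ∑_k a_k e(kα/2)` for `|α| ≤ 1`, `a_k = ½ r̂(k/2)`"). Obtained from Poisson summation for
`x ↦ r(2x)` (whose transform is `ξ ↦ ½ r̂(ξ/2)`), the `2ℤ`-periodisation of `r` being `r` itself
on `[-1, 1]`. [cite: BaluyotGoldstonSuriajayaTurnageButterbaugh2025, §8 (proof of Theorem 4)] -/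
theorem eq_tsum_fourier_half_mul_exp {r : ℝ → ℝ} (hc : Continuous r)
    (hsupp : ∀ t, 1 < |t| → r t = 0)
    (hsum : Summable fun n : ℤ ↦ ‖𝓕 (fun t : ℝ ↦ (r t : ℂ)) (n / 2)‖) {α : ℝ} (hα : |α| ≤ 1) :
    ((r α : ℝ) : ℂ) = ∑' n : ℤ, 1 / 2 * 𝓕 (fun t : ℝ ↦ (r t : ℂ)) (n / 2) *
      Complex.exp (π * Complex.I * n * α) := by
  have h0 := eq_zero_of_one_le_abs hc hsupp
  set f : ℝ → ℂ := fun t ↦ (r t : ℂ) with hf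
  set g : ℝ → ℂ := fun x ↦ f (2 * x) with hg
  have hgc : Continuous g :=
    (Complex.continuous_ofReal.comp hc).comp (continuous_const.mul continuous_id)
  have hg0 : ∀ x : ℝ, 1 ≤ |x| → g x = 0 := fun x hx ↦ by
    have : (1 : ℝ) ≤ |2 * x| := by rw [abs_mul, abs_two]; linarith [abs_nonneg x]
    simp [hg, hf, h0 _ this]
  have hO : g =O[cocompact ℝ] fun x : ℝ ↦ |x| ^ (-(2 : ℝ)) :=
    isBigO_cocompact_rpow_of_eq_zero hg0 2
  have hFg : ∀ ξ : ℝ, 𝓕 g ξ = 1 / 2 * 𝓕 f (ξ / 2) := fun ξ ↦ by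
    rw [hg, Literature.Analysis.Fourier.fourierIntegral_comp_mul_left f two_ne_zero ξ, abs_two,
      Complex.real_smul, inv_mul_eq_div]
    push_cast
    ring
  have hsumg : Summable fun n : ℤ ↦ 𝓕 g n := by
    simp_rw [hFg]
    exact (hsum.of_norm).mul_left _
  have hpsf :=
    Real.tsum_eq_tsum_fourier_of_rpow_decay_of_summable hgc one_lt_two hO hsumg (α / 2)
  have hlhs : ∑' n : ℤ, g (α / 2 + n) = r α := by
    rw [tsum_eq_single 0]
    · simp [hg, hf, show (2 : ℝ) * (α / 2) = α by ring]
    · intro n hn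
      have h1 : (1 : ℝ) ≤ |(n : ℝ)| := by exact_mod_cast Int.one_le_abs hn
      have h2 : (1 : ℝ) ≤ |2 * (α / 2 + n)| := by
        rw [show 2 * (α / 2 + (n : ℝ)) = 2 * n + α by ring]
        have := abs_sub_abs_le_abs_sub (2 * (n : ℝ)) (-α)
        rw [sub_neg_eq_add, abs_neg, abs_mul, abs_two] at this
        linarith
      simp [hg, hf, h0 _ h2]
  rw [hlhs] at hpsf
  rw [hpsf]
  refine tsum_congr fun n ↦ ?_
  rw [hFg, fourier_coe_apply]
  congr 1
  push_cast
  ring_nf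

/-- **Poisson summation at the half-integers** (BGSTB 2025, §8, "taking `λ = 2` in (PSF)":
`∑_k r̂(k/2) = 2 ∑_k r(2k) = 2 r(0)`), for a continuous `r` supported in `[-1, 1]` with
`∑_k |r̂(k/2)| < ∞`. [cite: BaluyotGoldstonSuriajayaTurnageButterbaugh2025, §8 (proof of Theorem 4)] -/
theorem tsum_fourier_half_eq {r : ℝ → ℝ} (hc : Continuous r) (hsupp : ∀ t, 1 < |t| → r t = 0)
    (hsum : Summable fun n : ℤ ↦ ‖𝓕 (fun t : ℝ ↦ (r t : ℂ)) (n / 2)‖) :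
    ∑' n : ℤ, 𝓕 (fun t : ℝ ↦ (r t : ℂ)) (n / 2) = 2 * r 0 := by
  have h := eq_tsum_fourier_half_mul_exp hc hsupp hsum (α := 0) (by simp)
  have h' : ∑' n : ℤ, 1 / 2 * 𝓕 (fun t : ℝ ↦ (r t : ℂ)) (n / 2) *
      Complex.exp (π * Complex.I * n * (0 : ℝ)) =
      1 / 2 * ∑' n : ℤ, 𝓕 (fun t : ℝ ↦ (r t : ℂ)) (n / 2) := by
    rw [← tsum_mul_left]
    refine tsum_congr fun n ↦ ?_
    simp
  rw [h'] at h
  rw [h]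
  ring

/-- The even-indexed half of `∑_k r̂(k/2)` is `∑_k r̂(k) = r(0)`; hence (BGSTB 2025, §8, display
(even = odd)) the odd-indexed half is `r(0)` as well. Stated with indicator weights.
[cite: BaluyotGoldstonSuriajayaTurnageButterbaugh2025, §8 (proof of Theorem 4)] -/
theorem tsum_fourier_half_even_eq {r : ℝ → ℝ} (hc : Continuous r)
    (hsupp : ∀ t, 1 < |t| → r t = 0)
    (hsum : Summable fun n : ℤ ↦ ‖𝓕 (fun t : ℝ ↦ (r t : ℂ)) (n / 2)‖) :
    ∑' n : ℤ, (if Even n then 𝓕 (fun t : ℝ ↦ (r t : ℂ)) (n / 2) else 0) = r 0 := by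
  classical
  set F : ℤ → ℂ := fun n ↦ if Even n then 𝓕 (fun t : ℝ ↦ (r t : ℂ)) (n / 2) else 0 with hF
  have hinj : Function.Injective fun m : ℤ ↦ 2 * m := mul_right_injective₀ two_ne_zero
  have hsuppF : Function.support F ⊆ Set.range fun m : ℤ ↦ 2 * m := by
    intro n hn
    rw [Function.mem_support, hF] at hn
    by_cases he : Even n
    · obtain ⟨m, rfl⟩ := he
      exact ⟨m, by ring⟩
    · exact (hn (by simp [he])).elim
  rw [← hinj.tsum_eq hsuppF]
  have hFm : ∀ m : ℤ, F (2 * m) = 𝓕 (fun t : ℝ ↦ (r t : ℂ)) m := fun m ↦ by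
    have hm : ((2 * m : ℤ) : ℝ) / 2 = m := by push_cast; ring
    simp only [hF, even_two_mul, if_true, hm]
  simp_rw [hFm]
  refine tsum_fourier_int_eq hc hsupp ?_
  have h2 : Summable fun m : ℤ ↦ ‖𝓕 (fun t : ℝ ↦ (r t : ℂ)) ((2 * m : ℤ) / 2)‖ :=
    hsum.comp_injective hinj
  refine Summable.of_norm ?_
  refine h2.congr fun m ↦ ?_
  congr 2
  push_cast
  ring

/-- The odd-indexed half: `∑_{k odd} r̂(k/2) = r(0)` (BGSTB 2025, §8, (even = odd)).
[cite: BaluyotGoldstonSuriajayaTurnageButterbaugh2025, §8 (proof of Theorem 4)] -/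
theorem tsum_fourier_half_odd_eq {r : ℝ → ℝ} (hc : Continuous r)
    (hsupp : ∀ t, 1 < |t| → r t = 0)
    (hsum : Summable fun n : ℤ ↦ ‖𝓕 (fun t : ℝ ↦ (r t : ℂ)) (n / 2)‖) :
    ∑' n : ℤ, (if Odd n then 𝓕 (fun t : ℝ ↦ (r t : ℂ)) (n / 2) else 0) = r 0 := by
  classical
  have hse : Summable fun n : ℤ ↦ (if Even n then 𝓕 (fun t : ℝ ↦ (r t : ℂ)) (n / 2) else 0) :=
    Summable.of_norm_bounded hsum fun n ↦ by split_ifs <;> simp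
  have hso : Summable fun n : ℤ ↦ (if Odd n then 𝓕 (fun t : ℝ ↦ (r t : ℂ)) (n / 2) else 0) :=
    Summable.of_norm_bounded hsum fun n ↦ by split_ifs <;> simp
  have hsplit : ∀ n : ℤ, 𝓕 (fun t : ℝ ↦ (r t : ℂ)) (n / 2) =
      (if Even n then 𝓕 (fun t : ℝ ↦ (r t : ℂ)) (n / 2) else 0) +
        (if Odd n then 𝓕 (fun t : ℝ ↦ (r t : ℂ)) (n / 2) else 0) := fun n ↦ by
    rcases Int.even_or_odd n with he | ho
    · simp [he, Int.not_odd_iff_even.mpr he]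
    · simp [ho, Int.not_even_iff_odd.mpr ho]
  have htot := tsum_fourier_half_eq hc hsupp hsum
  rw [tsum_congr hsplit, hse.tsum_add hso, tsum_fourier_half_even_eq hc hsupp hsum] at htot
  linear_combination htot

/-! ## §3. The moments `∫_{-1}^{1} |α| e^{iπkα} dα` -/

/-- An antiderivative of `x e^{icx}` (`c ≠ 0`): `d/dx [(1/c² − ix/c) e^{icx}] = x e^{icx}`.
[folklore] -/
private theorem hasDerivAt_antideriv_mul_exp {c : ℂ} (hc : c ≠ 0) (x : ℝ) :
    HasDerivAt (fun y : ℝ ↦ (1 / c ^ 2 - Complex.I * y / c) * Complex.exp (Complex.I * c * y))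
      ((x : ℂ) * Complex.exp (Complex.I * c * x)) x := by
  have h1 : HasDerivAt (fun y : ℝ ↦ (y : ℂ)) 1 x := (hasDerivAt_id x).ofReal_comp
  have h2 : HasDerivAt (fun y : ℝ ↦ 1 / c ^ 2 - Complex.I * y / c) (-(Complex.I * 1 / c)) x :=
    ((h1.const_mul Complex.I).div_const c).const_sub (1 / c ^ 2)
  have h3 : HasDerivAt (fun y : ℝ ↦ Complex.exp (Complex.I * c * y))
      (Complex.exp (Complex.I * c * x) * (Complex.I * c * 1)) x :=
    (h1.const_mul (Complex.I * c)).cexp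
  have h4 := h2.mul h3
  refine h4.congr_deriv ?_
  have hI : Complex.I * Complex.I = -1 := Complex.I_mul_I
  field_simp
  linear_combination (-(c * x)) * hI

/-- `‖e^{iπkα}‖ = 1`. [folklore] -/
private theorem norm_exp_pi_mul_I_mul (k : ℤ) (a : ℝ) :
    ‖Complex.exp (π * Complex.I * k * a)‖ = 1 := by
  rw [show (π : ℂ) * Complex.I * k * a = ((π * k * a : ℝ) : ℂ) * Complex.I by push_cast; ring,
    Complex.norm_exp_ofReal_mul_I]

/-- `∫_{-1}^{1} |α| dα = 1` (the `k = 0` moment). [folklore] -/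
private theorem integral_abs_mul_exp_zero :
    ∫ a in (-1 : ℝ)..1, ((|a| : ℝ) : ℂ) * Complex.exp (π * Complex.I * (0 : ℤ) * a) = 1 := by
  have h1 : ∫ a in (-1 : ℝ)..1, ((|a| : ℝ) : ℂ) * Complex.exp (π * Complex.I * (0 : ℤ) * a) =
      ((∫ a in (-1 : ℝ)..1, |a| : ℝ) : ℂ) := by
    rw [← intervalIntegral.integral_ofReal]
    refine intervalIntegral.integral_congr fun a _ ↦ ?_
    simp
  have hcont : Continuous fun a : ℝ ↦ |a| := continuous_abs
  have h2 : ∫ a in (-1 : ℝ)..1, |a| = 1 := by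
    rw [← intervalIntegral.integral_add_adjacent_intervals (b := 0) (hcont.intervalIntegrable _ _)
      (hcont.intervalIntegrable _ _)]
    have hl : ∫ a in (-1 : ℝ)..0, |a| = 1 / 2 := by
      rw [intervalIntegral.integral_congr (g := fun a : ℝ ↦ -a) fun a ha ↦ by
        rw [uIcc_of_le (by norm_num)] at ha; exact abs_of_nonpos ha.2]
      rw [intervalIntegral.integral_neg, integral_id]
      norm_num
    have hr : ∫ a in (0 : ℝ)..1, |a| = 1 / 2 := by
      rw [intervalIntegral.integral_congr (g := fun a : ℝ ↦ a) fun a ha ↦ by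
        rw [uIcc_of_le zero_le_one] at ha; exact abs_of_nonneg ha.1]
      rw [integral_id]
      norm_num
    rw [hl, hr]
    norm_num
  rw [h1, h2]
  simp

/-- For `k ≠ 0`: `∫_{-1}^{1} |α| e^{iπkα} dα = 2((−1)^k − 1)/(π²k²)` — that is, `0` for even `k ≠ 0`
and `−4/(π²k²)` for odd `k` (BGSTB 2025, §8: `2 Re ∫_0^1 α e(kα/2) dα`). [folklore] -/
private theorem integral_abs_mul_exp {k : ℤ} (hk : k ≠ 0) :
    ∫ a in (-1 : ℝ)..1, ((|a| : ℝ) : ℂ) * Complex.exp (π * Complex.I * k * a) =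
      2 * ((-1) ^ k - 1) / (π ^ 2 * (k : ℂ) ^ 2) := by
  have hπ : (π : ℂ) ≠ 0 := by exact_mod_cast Real.pi_ne_zero
  have hk' : (k : ℂ) ≠ 0 := by exact_mod_cast hk
  set c : ℂ := π * k with hc
  have hc0 : c ≠ 0 := mul_ne_zero hπ hk'
  set F : ℝ → ℂ := fun y ↦ (1 / c ^ 2 - Complex.I * y / c) * Complex.exp (Complex.I * c * y)
    with hF
  have hderiv : ∀ x : ℝ, HasDerivAt F ((x : ℂ) * Complex.exp (Complex.I * c * x)) x :=
    fun x ↦ hasDerivAt_antideriv_mul_exp hc0 x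
  have hexp : ∀ a : ℝ, Complex.exp (π * Complex.I * k * a) = Complex.exp (Complex.I * c * a) :=
    fun a ↦ by rw [hc]; ring_nf
  have hcont : Continuous fun a : ℝ ↦ ((|a| : ℝ) : ℂ) * Complex.exp (π * Complex.I * k * a) := by
    fun_prop
  have hcont' : Continuous fun a : ℝ ↦ (a : ℂ) * Complex.exp (Complex.I * c * a) := by
    fun_prop
  rw [← intervalIntegral.integral_add_adjacent_intervals (b := 0) (hcont.intervalIntegrable _ _)
    (hcont.intervalIntegrable _ _)]
  have hR : ∫ a in (0 : ℝ)..1, ((|a| : ℝ) : ℂ) * Complex.exp (π * Complex.I * k * a) =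
      F 1 - F 0 := by
    rw [intervalIntegral.integral_congr (g := fun a : ℝ ↦ (a : ℂ) * Complex.exp (Complex.I * c * a))
      fun a ha ↦ by
        rw [uIcc_of_le zero_le_one] at ha
        simp only [abs_of_nonneg ha.1, hexp]]
    exact intervalIntegral.integral_eq_sub_of_hasDerivAt (fun x _ ↦ hderiv x)
      (hcont'.intervalIntegrable _ _)
  have hL : ∫ a in (-1 : ℝ)..0, ((|a| : ℝ) : ℂ) * Complex.exp (π * Complex.I * k * a) =
      F (-1) - F 0 := by
    rw [intervalIntegral.integral_congr
      (g := fun a : ℝ ↦ -((a : ℂ) * Complex.exp (Complex.I * c * a))) fun a ha ↦ by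
        rw [uIcc_of_le (by norm_num : (-1 : ℝ) ≤ 0)] at ha
        simp only [abs_of_nonpos ha.2, hexp]
        push_cast
        ring]
    rw [intervalIntegral.integral_neg, intervalIntegral.integral_eq_sub_of_hasDerivAt
      (fun x _ ↦ hderiv x) (hcont'.intervalIntegrable _ _)]
    ring
  rw [hL, hR]
  have hs1 : Complex.exp (Complex.I * c) = (-1) ^ k := by
    rw [hc, show Complex.I * (π * k) = k * (π * Complex.I) by ring, Complex.exp_int_mul,
      Complex.exp_pi_mul_I]
  have hs2 : Complex.exp (-(Complex.I * c)) = (-1) ^ k := by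
    rw [Complex.exp_neg, hs1]
    rcases Int.even_or_odd k with he | ho
    · simp [he.neg_one_zpow]
    · simp [ho.neg_one_zpow]
  have hF1 : F 1 = (1 / c ^ 2 - Complex.I / c) * (-1) ^ k := by
    simp only [hF]
    push_cast
    rw [mul_one, mul_one, hs1]
  have hF0 : F 0 = 1 / c ^ 2 := by
    simp only [hF]
    push_cast
    rw [mul_zero, mul_zero, zero_div, sub_zero, Complex.exp_zero, mul_one]
  have hFm1 : F (-1) = (1 / c ^ 2 + Complex.I / c) * (-1) ^ k := by
    simp only [hF]
    push_cast
    rw [mul_neg, mul_one, mul_neg, mul_one, hs2]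
    ring
  rw [hF1, hF0, hFm1, hc]
  field_simp
  ring

/-! ## §4. Termwise integration against `|α|` -/

/-- Termwise integration of the Fourier expansion against `|α|` on `[-1, 1]`:
`∫_{-1}^{1} |α| r(α) dα = ∑_k ½ r̂(k/2) ∫_{-1}^{1} |α| e^{iπkα} dα` (BGSTB 2025, §8: "the series
converges to `r(α)` … thus `r(0) + 2∫_0^1 α r(α) dα = ½∑_k r̂(k/2) + ∑_k r̂(k/2) Re ∫_0^1 α e(kα/2) dα`");
justified here by absolute convergence (domination by `∑_k |r̂(k/2)|`), not by bounded variation.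
[cite: BaluyotGoldstonSuriajayaTurnageButterbaugh2025, §8 (proof of Theorem 4)] -/
theorem integral_abs_mul_eq_tsum {r : ℝ → ℝ} (hc : Continuous r) (hsupp : ∀ t, 1 < |t| → r t = 0)
    (hsum : Summable fun n : ℤ ↦ ‖𝓕 (fun t : ℝ ↦ (r t : ℂ)) (n / 2)‖) :
    ∫ a in (-1 : ℝ)..1, ((|a| : ℝ) : ℂ) * (r a : ℂ) =
      ∑' n : ℤ, 1 / 2 * 𝓕 (fun t : ℝ ↦ (r t : ℂ)) (n / 2) *
        ∫ a in (-1 : ℝ)..1, ((|a| : ℝ) : ℂ) * Complex.exp (π * Complex.I * n * a) := by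
  set c : ℤ → ℂ := fun n ↦ 1 / 2 * 𝓕 (fun t : ℝ ↦ (r t : ℂ)) (n / 2) with hcdef
  have hcs : Summable fun n ↦ ‖c n‖ := by
    refine (hsum.mul_left (1 / 2)).congr fun n ↦ ?_
    rw [hcdef, norm_mul]
    norm_num
  set G : ℤ → ℝ → ℂ := fun n a ↦ ((|a| : ℝ) : ℂ) * (c n * Complex.exp (π * Complex.I * n * a))
    with hG
  have hpt : ∀ a ∈ uIcc (-1 : ℝ) 1, ((|a| : ℝ) : ℂ) * (r a : ℂ) = ∑' n, G n a := by
    intro a ha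
    rw [uIcc_of_le (by norm_num)] at ha
    have hα : |a| ≤ 1 := abs_le.mpr ⟨ha.1, ha.2⟩
    rw [eq_tsum_fourier_half_mul_exp hc hsupp hsum hα, ← tsum_mul_left]
  rw [intervalIntegral.integral_congr hpt]
  have hle : (-1 : ℝ) ≤ 1 := by norm_num
  have hGcont : ∀ n, Continuous (G n) := fun n ↦ by
    simp only [hG]
    fun_prop
  have hGint : ∀ n, Integrable (G n) (volume.restrict (Ioc (-1 : ℝ) 1)) := fun n ↦
    (hGcont n).integrableOn_Ioc
  have hGnorm : ∀ n, ∀ a ∈ Ioc (-1 : ℝ) 1, ‖G n a‖ ≤ ‖c n‖ := by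
    intro n a ha
    have hα : |a| ≤ 1 := abs_le.mpr ⟨ha.1.le, ha.2⟩
    simp only [hG, norm_mul, Complex.norm_real, Real.norm_eq_abs, abs_abs, norm_exp_pi_mul_I_mul,
      mul_one]
    exact mul_le_of_le_one_left (norm_nonneg _) hα
  have hsumint : Summable fun n ↦ ∫ a, ‖G n a‖ ∂(volume.restrict (Ioc (-1 : ℝ) 1)) := by
    refine Summable.of_nonneg_of_le (fun n ↦ integral_nonneg fun a ↦ norm_nonneg _)
      (fun n ↦ ?_) (hcs.mul_left 2)
    calc ∫ a in Ioc (-1 : ℝ) 1, ‖G n a‖ ≤ ∫ _ in Ioc (-1 : ℝ) 1, ‖c n‖ :=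
          setIntegral_mono_on (hGint n).norm (integrableOn_const measure_Ioc_lt_top.ne)
            measurableSet_Ioc (hGnorm n)
      _ = 2 * ‖c n‖ := by
          rw [setIntegral_const, Real.volume_real_Ioc_of_le hle, smul_eq_mul]
          norm_num
  rw [intervalIntegral.integral_of_le hle, ← integral_tsum_of_summable_integral_norm hGint hsumint]
  refine tsum_congr fun n ↦ ?_
  rw [intervalIntegral.integral_of_le hle, ← integral_const_mul]
  congr 1
  funext a
  simp only [hG, hcdef]
  ring

/-! ## §5. The identity `∑_k r̂(k/2) p_{k/2} = r(0) + 2 ∫_0^1 α r(α) dα` -/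

/-- Evenness: `2 ∫_0^1 α r(α) dα = ∫_{-1}^{1} |α| r(α) dα`. [folklore] -/
private theorem two_mul_integral_eq_integral_abs_mul {r : ℝ → ℝ} (hc : Continuous r)
    (heven : ∀ t, r (-t) = r t) :
    2 * ∫ a in (0 : ℝ)..1, a * r a = ∫ a in (-1 : ℝ)..1, |a| * r a := by
  have hcont : Continuous fun a : ℝ ↦ |a| * r a := continuous_abs.mul hc
  rw [← intervalIntegral.integral_add_adjacent_intervals (b := 0) (hcont.intervalIntegrable _ _)
    (hcont.intervalIntegrable _ _)]
  have hl : ∫ a in (-1 : ℝ)..0, |a| * r a = ∫ a in (0 : ℝ)..1, a * r a := by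
    have h1 : ∫ a in (0 : ℝ)..1, (fun a : ℝ ↦ |a| * r a) (-a) =
        ∫ a in (-1 : ℝ)..0, (fun a : ℝ ↦ |a| * r a) a := by
      rw [intervalIntegral.integral_comp_neg (fun a : ℝ ↦ |a| * r a)]
      norm_num
    simp only at h1
    rw [← h1]
    refine intervalIntegral.integral_congr fun a ha ↦ ?_
    rw [uIcc_of_le zero_le_one] at ha
    simp only [abs_neg, abs_of_nonneg ha.1, heven]
  have hr : ∫ a in (0 : ℝ)..1, |a| * r a = ∫ a in (0 : ℝ)..1, a * r a := by
    refine intervalIntegral.integral_congr fun a ha ↦ ?_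
    rw [uIcc_of_le zero_le_one] at ha
    simp only [abs_of_nonneg ha.1]
  rw [hl, hr]
  ring

/-- **The Fourier-analytic core of BGSTB 2025, Theorem 4** (AH-free; the AH-Density table is fed in
as the explicit function `AH.densityTable p₀`, for an ARBITRARY real `p₀`): for a continuous even
`r : ℝ → ℝ` supported in `[-1, 1]` with `∑_k |r̂(k/2)| < ∞`,
`∑_{k ∈ ℤ} r̂(k/2) · densityTable p₀ k = r(0) + 2 ∫_0^1 α r(α) dα`.
Proof as in BGSTB §8: splitting the table, `∑_k r̂(k/2) p_{k/2} = ½ r̂(0) + (p₀ − ½) ∑_{k even} r̂(k/2)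
+ (3/2 − p₀) ∑_{k odd} r̂(k/2) − (2/π²) ∑_{k odd} r̂(k/2)/k²`, the even and odd sums both equal `r(0)`
(Poisson summation), so the `p₀`-terms cancel; and `2∫_0^1 α r = ∫_{-1}^1 |α| r = ½ r̂(0) −
(2/π²) ∑_{k odd} r̂(k/2)/k²` by termwise integration of the Fourier expansion. (The printed first
display of §8 writes the `k = 0` coefficient as `p₀ − ½` instead of `p₀`, dropping `½ r̂(0)`; the same
`½ r̂(0)` is dropped in its last display, so the printed conclusion (Theorem 4) is correct as stated.)
[cite: BaluyotGoldstonSuriajayaTurnageButterbaugh2025, Theorem 4 and §8] -/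
theorem tsum_fourier_half_mul_densityTable {r : ℝ → ℝ} (hc : Continuous r)
    (heven : ∀ t, r (-t) = r t) (hsupp : ∀ t, 1 < |t| → r t = 0)
    (hsum : Summable fun n : ℤ ↦ ‖𝓕 (fun t : ℝ ↦ (r t : ℂ)) (n / 2)‖) (p₀ : ℝ) :
    ∑' k : ℤ, 𝓕 (fun t : ℝ ↦ (r t : ℂ)) ((k : ℝ) / 2) * (densityTable p₀ k : ℂ) =
      ((r 0 + 2 * ∫ a in (0 : ℝ)..1, a * r a : ℝ) : ℂ) := by
  classical
  obtain ⟨R, hR⟩ : ∃ R : ℤ → ℂ, ∀ k, R k = 𝓕 (fun t : ℝ ↦ (r t : ℂ)) ((k : ℝ) / 2) :=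
    ⟨_, fun k ↦ rfl⟩
  have hRs : Summable fun k ↦ ‖R k‖ := by simp only [hR]; exact hsum
  have hπ : (π : ℂ) ≠ 0 := by exact_mod_cast Real.pi_ne_zero
  -- the four pieces of the table
  set A0 : ℤ → ℂ := fun k ↦ if k = 0 then R k else 0 with hA0
  set Ae : ℤ → ℂ := fun k ↦ if Even k then R k else 0 with hAe
  set Ao : ℤ → ℂ := fun k ↦ if Odd k then R k else 0 with hAo
  set Aq : ℤ → ℂ := fun k ↦ if Odd k then R k / (k : ℂ) ^ 2 else 0 with hAq
  have hA0s : Summable A0 := Summable.of_norm_bounded hRs fun k ↦ by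
    simp only [hA0]; split_ifs <;> simp
  have hAes : Summable Ae := Summable.of_norm_bounded hRs fun k ↦ by
    simp only [hAe]; split_ifs <;> simp
  have hAos : Summable Ao := Summable.of_norm_bounded hRs fun k ↦ by
    simp only [hAo]; split_ifs <;> simp
  have hAqs : Summable Aq := Summable.of_norm_bounded hRs fun k ↦ by
    simp only [hAq]
    split_ifs with ho
    · rw [norm_div, norm_pow, Complex.norm_intCast]
      have hk : k ≠ 0 := by rintro rfl; exact (Int.not_even_iff_odd.mpr ho) Even.zero
      have h1 : (1 : ℝ) ≤ |(k : ℝ)| ^ 2 := by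
        have : (1 : ℝ) ≤ |(k : ℝ)| := by exact_mod_cast Int.one_le_abs hk
        nlinarith
      exact div_le_self (norm_nonneg _) h1
    · simp
  have hA0t : ∑' k, A0 k = R 0 := by
    rw [tsum_eq_single 0 (fun k hk ↦ by simp [hA0, hk])]
    simp [hA0]
  have hAet : ∑' k, Ae k = r 0 := by
    have h := tsum_fourier_half_even_eq hc hsupp hsum
    simp only [← hR] at h
    exact h
  have hAot : ∑' k, Ao k = r 0 := by
    have h := tsum_fourier_half_odd_eq hc hsupp hsum
    simp only [← hR] at h
    exact h
  -- (i) the left-hand side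
  have hpt : ∀ k : ℤ, R k * (densityTable p₀ k : ℂ) =
      1 / 2 * A0 k + ((p₀ : ℂ) - 1 / 2) * Ae k + (3 / 2 - (p₀ : ℂ)) * Ao k -
        2 / (π : ℂ) ^ 2 * Aq k := by
    intro k
    simp only [hA0, hAe, hAo, hAq]
    rcases eq_or_ne k 0 with rfl | hk
    · simp only [densityTable_zero, if_true, Even.zero, Int.not_odd_zero, if_false]
      ring
    · rcases Int.even_or_odd k with he | ho
      · have hno : ¬Odd k := Int.not_odd_iff_even.mpr he
        simp only [densityTable_of_even hk he, hk, he, hno, if_true, if_false]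
        push_cast
        ring
      · have hne : ¬Even k := Int.not_even_iff_odd.mpr ho
        have hk' : (k : ℂ) ≠ 0 := by exact_mod_cast hk
        simp only [densityTable_of_odd ho, hk, ho, hne, if_true, if_false]
        push_cast
        field_simp
        ring
  have hL : HasSum (fun k ↦ R k * (densityTable p₀ k : ℂ))
      (1 / 2 * R 0 + ((p₀ : ℂ) - 1 / 2) * r 0 + (3 / 2 - (p₀ : ℂ)) * r 0 -
        2 / (π : ℂ) ^ 2 * ∑' k, Aq k) := by
    have h := (((hA0s.hasSum.mul_left (1 / 2)).add
      (hAes.hasSum.mul_left ((p₀ : ℂ) - 1 / 2))).add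
      (hAos.hasSum.mul_left (3 / 2 - (p₀ : ℂ)))).sub (hAqs.hasSum.mul_left (2 / (π : ℂ) ^ 2))
    rw [hA0t, hAet, hAot] at h
    rw [show (fun k ↦ R k * (densityTable p₀ k : ℂ)) = fun k ↦
      1 / 2 * A0 k + ((p₀ : ℂ) - 1 / 2) * Ae k + (3 / 2 - (p₀ : ℂ)) * Ao k -
        2 / (π : ℂ) ^ 2 * Aq k from funext hpt]
    exact h
  -- (ii) the right-hand side
  have hJ : ∀ n : ℤ, ∫ a in (-1 : ℝ)..1, ((|a| : ℝ) : ℂ) * Complex.exp (π * Complex.I * n * a) =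
      (if n = 0 then (1 : ℂ) else 0) +
        (if Odd n then -4 / ((π : ℂ) ^ 2 * (n : ℂ) ^ 2) else 0) := by
    intro n
    rcases eq_or_ne n 0 with rfl | hn
    · rw [integral_abs_mul_exp_zero]
      simp
    · rw [integral_abs_mul_exp hn]
      have hn' : (n : ℂ) ≠ 0 := by exact_mod_cast hn
      rcases Int.even_or_odd n with he | ho
      · simp only [hn, if_false, he.neg_one_zpow, Int.not_odd_iff_even.mpr he, sub_self,
          mul_zero, zero_div, add_zero]
      · simp only [hn, if_false, ho.neg_one_zpow, ho, if_true, zero_add]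
        ring
  have hRHS : ((r 0 + 2 * ∫ a in (0 : ℝ)..1, a * r a : ℝ) : ℂ) =
      r 0 + (1 / 2 * R 0 - 2 / (π : ℂ) ^ 2 * ∑' k, Aq k) := by
    have h1 : ((2 * ∫ a in (0 : ℝ)..1, a * r a : ℝ) : ℂ) =
        ∫ a in (-1 : ℝ)..1, ((|a| : ℝ) : ℂ) * (r a : ℂ) := by
      rw [two_mul_integral_eq_integral_abs_mul hc heven, ← intervalIntegral.integral_ofReal]
      simp only [Complex.ofReal_mul]
    have h2 := integral_abs_mul_eq_tsum hc hsupp hsum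
    have h3 : ∑' n : ℤ, 1 / 2 * 𝓕 (fun t : ℝ ↦ (r t : ℂ)) (n / 2) *
        ∫ a in (-1 : ℝ)..1, ((|a| : ℝ) : ℂ) * Complex.exp (π * Complex.I * n * a) =
        1 / 2 * R 0 - 2 / (π : ℂ) ^ 2 * ∑' k, Aq k := by
      have hpt2 : ∀ n : ℤ, 1 / 2 * 𝓕 (fun t : ℝ ↦ (r t : ℂ)) (n / 2) *
          ∫ a in (-1 : ℝ)..1, ((|a| : ℝ) : ℂ) * Complex.exp (π * Complex.I * n * a) =
          1 / 2 * A0 n - 2 / (π : ℂ) ^ 2 * Aq n := by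
        intro n
        rw [hJ n, ← hR]
        simp only [hA0, hAq]
        rcases eq_or_ne n 0 with rfl | hn
        · simp only [if_true, Int.not_odd_zero, if_false]
          ring
        · have hn' : (n : ℂ) ≠ 0 := by exact_mod_cast hn
          by_cases ho : Odd n
          · simp only [hn, ho, if_true, if_false]
            field_simp
            ring
          · simp only [hn, ho, if_false]
            ring
      rw [tsum_congr hpt2]
      have h := (hA0s.hasSum.mul_left (1 / 2)).sub (hAqs.hasSum.mul_left (2 / (π : ℂ) ^ 2))
      rw [hA0t] at h
      exact h.tsum_eq
    rw [Complex.ofReal_add, h1, h2, h3]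
  simp only [← hR]
  rw [hL.tsum_eq, hRHS]
  ring

end AH

/-! ## §6. BGSTB 2025, Theorem 4 for continuous test functions; the literal typing -/

/-- **BGSTB 2025, Theorem 4, with the test function continuous (PROVED).** "Suppose both `r(t)`
and `r̂(α)` are even `L¹(ℝ)` functions with bounded variation, and suppose further that `r(α)` has
support in `|α| ≤ 1`. Then assuming AH-Density, we have `∑_{k∈ℤ} r̂(k/2) p_{k/2} = r(0) +
2∫_0^1 α r(α) dα`." This is the statement `bgstb2025_theorem4` of
`AlternativeHypothesisFormFactor.lean` with ONE hypothesis added: `Continuous r`. The printed proof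
uses it ("Since `r(α)` is continuous and supported in `|α| ≤ 1`, we have `r(k) = 0` for `k ≠ 0`",
§8) — for the authors `r ∈ L¹` with `r̂ ∈ L¹` is (a.e. equal to) a continuous function; for the
Lean statement, whose conclusion mentions the pointwise values `r(0)`, `r(α)`, the hypothesis must
be explicit (without it the typed claim is inconsistent with AH-Density:
`not_ahDensity_of_bgstb2025_theorem4`). Proof: under `AHDensity δ` the limiting densities are
`p_{k/2} = densityTable p₀ k` (uniqueness of limits), `∑_k |r̂(k/2)| < ∞` because `r̂ ∈ L¹ ∩ BV`
(`AH.summable_norm_sample`), and the identity is `AH.tsum_fourier_half_mul_densityTable`. The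
hypotheses `Integrable r`, `BoundedVariationOn r univ` are not needed (kept for fidelity). LABEL:
NOT RH-BEARING (a conditional on the AH-Density predicate; nothing here bears on RH or AH).
[cite: BaluyotGoldstonSuriajayaTurnageButterbaugh2025, Theorem 4 and §8] -/
theorem bgstb2025_theorem4_of_continuous :
    ∀ δ : ℝ, 0 < δ → δ ≤ 1 / 2 → AHDensity δ → ∀ p : ℤ → ℝ,
      (∀ k : ℤ, AH.HasLimitingDensity k δ (p k)) →
      ∀ r : ℝ → ℝ, Continuous r → Integrable r → (∀ t, r (-t) = r t) →
        BoundedVariationOn r univ → (∀ t, 1 < |t| → r t = 0) →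
        Integrable (𝓕 (fun t : ℝ ↦ (r t : ℂ))) →
        BoundedVariationOn (𝓕 (fun t : ℝ ↦ (r t : ℂ))) univ →
          ∑' k : ℤ, 𝓕 (fun t : ℝ ↦ (r t : ℂ)) ((k : ℝ) / 2) * (p k : ℂ) =
            ((r 0 + 2 * ∫ a in (0 : ℝ)..1, a * r a : ℝ) : ℂ) := by
  intro δ _ _ hAHD p hp r hc _ heven _ hsupp hint hbv
  obtain ⟨p₀, -, -, hdens⟩ := hAHD
  have hpk : ∀ k, p k = AH.densityTable p₀ k := fun k ↦ (hp k).unique (hdens k)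
  have hsum : Summable fun n : ℤ ↦ ‖𝓕 (fun t : ℝ ↦ (r t : ℂ)) (n / 2)‖ := by
    have := AH.summable_norm_sample hint hbv (h := 1 / 2) (by norm_num)
    refine this.congr fun k ↦ ?_
    rw [mul_one_div]
  simp_rw [hpk]
  exact AH.tsum_fourier_half_mul_densityTable hc heven hsupp hsum p₀

/-- The indicator of `{0}` (the test function witnessing `not_ahDensity_of_bgstb2025_theorem4`) has
bounded variation on `ℝ`: it is monotone on `(-∞, 0]` and, being even, has the same variation on
`[0, ∞)`. [folklore] -/
private theorem boundedVariationOn_ite_eq_zero :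
    BoundedVariationOn (fun t : ℝ ↦ if t = 0 then (1 : ℝ) else 0) univ := by
  set r : ℝ → ℝ := fun t ↦ if t = 0 then (1 : ℝ) else 0 with hr
  have hmono : MonotoneOn r (Iic 0) := by
    intro a _ b hb hab
    by_cases hb0 : b = 0
    · have : r b = 1 := by simp [hr, hb0]
      rw [this]
      simp only [hr]
      split_ifs <;> norm_num
    · have ha0 : a ≠ 0 := fun ha0 ↦ hb0 (le_antisymm hb (ha0 ▸ hab))
      simp [hr, ha0, hb0]
  have hbdd : ∀ x ∈ Iic (0 : ℝ), |r x| ≤ 1 := fun x _ ↦ by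
    simp only [hr]
    split_ifs <;> norm_num
  have hleft : BoundedVariationOn r (Iic 0) := hmono.boundedVariationOn hbdd
  have heven : r ∘ Neg.neg = r := by
    funext t
    simp [hr, neg_eq_zero]
  have hright : BoundedVariationOn r (Ici 0) := by
    have h := eVariationOn.comp_eq_of_antitoneOn r (t := Iic (0 : ℝ)) Neg.neg
      (fun a _ b _ hab ↦ neg_le_neg hab)
    rw [heven, Set.image_neg_Iic, neg_zero] at h
    rw [BoundedVariationOn, ← h]
    exact hleft
  rw [BoundedVariationOn, ← Iic_union_Ici (a := (0 : ℝ)),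
    eVariationOn.union r isGreatest_Iic isLeast_Ici]
  exact ENNReal.add_ne_top.mpr ⟨hleft, hright⟩

/-- **The literal typing refutes AH-Density.** `bgstb2025_theorem4` as typed in
`AlternativeHypothesisFormFactor.lean` (no continuity of `r`) quantifies over ALL functions
`r : ℝ → ℝ` satisfying the integrability / bounded-variation / support hypotheses, and its
conclusion involves the pointwise value `r(0)`; the indicator of `{0}` satisfies every hypothesis
(it is a.e. zero, so `r̂ = 0`), its left side is `0` and its right side is `r(0) = 1`. Hence the
typed claim, together with the existence of the limiting densities asserted by `AHDensity δ`,
yields `0 = 1`: for every admissible bin half-width `δ`, `bgstb2025_theorem4 → ¬ AHDensity δ`.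
This records precisely what is wrong with the literal typing (ERRATUM E-ah-4 of cell `rh-crit/ah`;
the corrected, proved statement is `bgstb2025_theorem4_of_continuous`); it is NOT evidence about
AH-Density. LABEL: NOT RH-BEARING. [cite: BaluyotGoldstonSuriajayaTurnageButterbaugh2025, Theorem 4 and §8] -/
theorem not_ahDensity_of_bgstb2025_theorem4 (h : bgstb2025_theorem4) {δ : ℝ} (hδ : 0 < δ)
    (hδ' : δ ≤ 1 / 2) : ¬ AHDensity δ := by
  intro hAHD
  obtain ⟨p₀, h1, h2, hdens⟩ := hAHD
  set r : ℝ → ℝ := fun t ↦ if t = 0 then (1 : ℝ) else 0 with hr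
  have hz : (volume : Measure ℝ) {(0 : ℝ)} = 0 := measure_singleton 0
  have hr0 : r =ᵐ[volume] (0 : ℝ → ℝ) := by
    filter_upwards [compl_mem_ae_iff.mpr hz] with t ht
    simp only [mem_compl_iff, mem_singleton_iff] at ht
    simp [hr, ht]
  have hint : Integrable r := (integrable_zero ℝ ℝ volume).congr hr0.symm
  have heven : ∀ t, r (-t) = r t := fun t ↦ by simp [hr, neg_eq_zero]
  have hbv : BoundedVariationOn r univ := boundedVariationOn_ite_eq_zero
  have hsupp : ∀ t, 1 < |t| → r t = 0 := fun t ht ↦ by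
    have : t ≠ 0 := by
      rintro rfl
      norm_num at ht
    simp [hr, this]
  have hF : 𝓕 (fun t : ℝ ↦ (r t : ℂ)) = 0 := by
    funext w
    rw [Real.fourier_real_eq, Pi.zero_apply]
    refine integral_eq_zero_of_ae (hr0.mono fun t ht ↦ ?_)
    simp only [Pi.zero_apply] at ht
    simp [ht]
  have hFint : Integrable (𝓕 (fun t : ℝ ↦ (r t : ℂ))) := by
    rw [hF]
    exact integrable_zero ℝ ℂ volume
  have hFbv : BoundedVariationOn (𝓕 (fun t : ℝ ↦ (r t : ℂ))) univ := by
    rw [hF, BoundedVariationOn, eVariationOn.constant_on]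
    · exact ENNReal.zero_ne_top
    · rintro _ ⟨x, -, rfl⟩ _ ⟨y, -, rfl⟩
      rfl
  have key := h δ hδ hδ' ⟨p₀, h1, h2, hdens⟩ (fun k ↦ AH.densityTable p₀ k) hdens r hint heven
    hbv hsupp hFint hFbv
  have hlhs :
      ∑' k : ℤ, 𝓕 (fun t : ℝ ↦ (r t : ℂ)) ((k : ℝ) / 2) * (AH.densityTable p₀ k : ℂ) = 0 := by
    simp [hF]
  have hrhs : r 0 + 2 * ∫ a in (0 : ℝ)..1, a * r a = 1 := by
    have h0 : ∫ a in (0 : ℝ)..1, a * r a = 0 := by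
      rw [intervalIntegral.integral_congr (g := fun _ : ℝ ↦ (0 : ℝ)) fun a _ ↦ by
        by_cases ha : a = 0
        · simp [ha]
        · simp [hr, ha]]
      simp
    rw [h0]
    simp [hr]
  rw [hlhs, hrhs] at key
  simp at key

end Literature.NumberTheory.LFunctions

end
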